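import Summits.BirchSwinnertonDyer.BirchSwinnertonDyer.Theorems.GenusKolyvaginAtTwoGenusDeepSupplyAtTwoNegDiscNarrowOfWallU2
import HarnessLib

/-!
# Crux 23491 `GenusDeepSupplyAtTwoNegDiscNarrow` — skeleton «wall_road» (LEAD bsd-line-gk2-p1 g29): the crux BY NAME from FIVE stubs, every one an
# EXISTING route item (or a conjunction of such); NO K-item, NO beyond-print stub

Registered composition: `GenusDeepSupplyAtTwoNegDiscNarrow_of` = `GenusSupplyNarrow.PrimeFrame.genusDeepSupplyAtTwoNegDiscNarrow_of_wallRows_U2`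
(p791879 ✓) fed by the stubs.  **No summit is proved by a line; the crux is NOT closed (the stubs are OPEN route items); BSD is NOT proved.**

Stubs (5):
* `stub_wallRankZeroAtTwo` — WALL row 1: BSD₂ for non-CM curves of analytic rank 0 = the four `ByReductionTypeAtTwo` rows 19095–19098 together
  (each row is this statement restricted to one reduction type at 2).
* `stub_minimalTwinBSDTwo` — U₂ (22985) by name.
* `stub_kolyvaginRelationAtTwo` — Q2 (24880) by name.
* `stub_rankOneTwoConverse` — the rank-one 2-converse for non-CM globally minimal curves = items 19220 (good-ordinary ∪ multiplicative at 2) and 24948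
  (the rest) together.
* `stub_printFacts` — GZ-all-levels (24148) ∧ Modularity (19382) ∧ 2-parity (23327) ∧ GZK (19921) ∧ entire L (19273) ∧ Milne (24149), by name.
Why the K-items disappeared: LEAD-BRIEF-g29 §1–§2 (phantom-Selmer curves are framed at (α)-primes; elsewhere (NPh_K) holds by uniqueness of the phantom;
K₁ is the pair ledger against `#Ш(E/K)[2^∞] = 1`).
-/

set_option autoImplicit false
set_option linter.dupNamespace false

noncomputable section

open scoped Classical

namespace Summit.BirchSwinnertonDyer.BirchSwinnertonDyer.Cruxes.GenusDeepSupplyAtTwoNegDiscNarrow.WallRoad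

open WeierstrassCurve Literature.NumberTheory.EllipticCurves
open Summit.BirchSwinnertonDyer.BirchSwinnertonDyer.Theses.GenusKolyvaginAtTwo
open Summit.BirchSwinnertonDyer.BirchSwinnertonDyer.Theses.ByReductionTypeAtTwo
  (GoodOrdinaryRankZeroAtTwo MultiplicativeRankZeroAtTwo SupersingularRankZeroAtTwo AdditiveRankZeroAtTwo)

/-- **WALL row 1 (stub = items 19095–19098 together): BSD₂ for non-CM curves of analytic rank `0`.** -/
theorem stub_wallRankZeroAtTwo :
    ∀ (W : WeierstrassCurve ℚ) [W.IsElliptic] [W.IsGloballyMinimal], ¬ W.HasCM → W.analyticRank = 0 → BSDp W 2 := by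
  sorry

/-- **U₂ (stub = item 22985 by name).** -/
theorem stub_minimalTwinBSDTwo : MinimalTwinBSDTwo := by
  sorry

/-- **Q2 (stub = item 24880 by name).** -/
theorem stub_kolyvaginRelationAtTwo : KolyvaginRelationAtTwo := by
  sorry

/-- **The rank-one 2-converse for non-CM globally minimal curves (stub = items 19220 and 24948 together).** -/
theorem stub_rankOneTwoConverse :
    ∀ (V : WeierstrassCurve ℚ) [V.IsElliptic] [V.IsGloballyMinimal], ¬ V.HasCM → V.selmerCorank 2 = 1 → V.analyticRank = 1 := by
  sorry

/-- **PRINT (stub = items 24148 ∧ 19382 ∧ 23327 ∧ 19921 ∧ 19273 ∧ 24149 by name).** -/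
theorem stub_printFacts : GrossZagierAllLevels ∧ ModularityExistsNewform ∧ TwoParityDD ∧ MultPublishedInputsAtTwo ∧ EntireLFunctionRat ∧
    MilneAnyModel := by
  sorry

/-- **COMPOSITION (kernel-checked, no `sorry` of its own): the crux 23491 BY NAME from the five stubs** — LEAD g29's
`GenusSupplyNarrow.PrimeFrame.genusDeepSupplyAtTwoNegDiscNarrow_of_wallRows_U2` (p791879).  Nothing is closed; BSD is NOT proved. -/
theorem GenusDeepSupplyAtTwoNegDiscNarrow_of : GenusDeepSupplyAtTwoNegDiscNarrow := by
  obtain ⟨hGZ, hmod, hpar, hGZK, hL, hMi⟩ := stub_printFacts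
  exact Summit.BirchSwinnertonDyer.BirchSwinnertonDyer.Theorems.GenusSupplyNarrow.PrimeFrame.genusDeepSupplyAtTwoNegDiscNarrow_of_wallRows_U2 hGZ
    hmod hpar (fun V _ _ hV _ hco ↦ stub_rankOneTwoConverse V hV hco) (fun V _ _ hV _ hco ↦ stub_rankOneTwoConverse V hV hco)
    (fun W _ _ hcm hr0 _ ↦ stub_wallRankZeroAtTwo W hcm hr0) (fun W _ _ hcm hr0 _ ↦ stub_wallRankZeroAtTwo W hcm hr0)
    (fun W _ _ hcm hr0 _ ↦ stub_wallRankZeroAtTwo W hcm hr0) (fun W _ _ hcm hr0 _ ↦ stub_wallRankZeroAtTwo W hcm hr0)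
    stub_minimalTwinBSDTwo stub_kolyvaginRelationAtTwo hGZK hL hMi

end Summit.BirchSwinnertonDyer.BirchSwinnertonDyer.Cruxes.GenusDeepSupplyAtTwoNegDiscNarrow.WallRoad

end
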